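import Summits.QuantumFields.YangMills.Theorems.BalabanUVNodesN11OffTopSupportsGenerationStep
import Summits.QuantumFields.YangMills.Theorems.BalabanUVNodesN11TkBranchMassBoundCore

/-!
# DAG node N11 ∕ key K1⁹ — THE L¹ STEP of the off-top support induction ((R3) of the located sentence) and the weights-of-record inputs of both steps: a uniform
# `∫⁻`-bound along sections propagates through one 11a generation (NO absolute continuity needed); the Gaussian-bare empty-branch A-weight is blind,
# measurable, with a constant fibre integral (count-neutral, LOCATED)

HEADER — WORK-UNIT METADATA.  Cell `pub-ymgap`, YM-PLAN Track A (HUMAN RULING D-0062), seat `pub-ymgap-dag-n11-d` (g37; N11 [B14], s2), route `BalabanUVNodes`, item K1⁹ =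
stmt-QuantumFields-27364 (helper lane, `--kind proof --supports 27364 --as helper`, count-neutral).  [III] = [Balaban1988Convergent].  CONSUMED BY NAME, nothing modified: this seat's
P `…N11OffTopSupportsGenerationStep` (`measurable_vUpdate`, `measurePreserving_restrict_subfinset`, `measurePreserving_glue`), O2 `…N11K1SupportsOffTopFirstStep`
(`w_gaussBare_empty_update_eq`, `integral_afibre_gaussBare_empty_pos`), g9 `…N11TkOpMeasurable` (`measurable_chiAW`), K `…N11K1SupportsOmegaTopGaussianDial`
(`chiAW_empty_eq_chiSmallAW'`), def-T's 11a `Node00.TkOfRecord` (`genOp`, `aOp_of_indep`, `kernelRT_apply`, `genDataOfRecord`), r11 ∕ 12a (`B14.Eq316.chiK`, `chiAW`), the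
disintegration API `T4AveragingDisintegration` (`margDensity`, `condLaw`), this seat's g10 `…N11TkBranchMassBoundCore` (★ `lintegral_margDensity_condLaw_le` — the disintegration
INEQUALITY of the kernel transport WITHOUT absolute continuity — and `ofReal_integral_le_lintegral_ofReal_of_nonneg`, both CITED, not re-declared; dag-lead name note WORDS 101),
Mathlib (`lintegral_prod_symm`, `lintegral_const_mul`, `Measurable.lintegral_kernel_prod_right'`).

WHY (P's header, «the L¹-bound step and the induction at the record are the sequel»).  P's positivity step needs, at generation `j+1`, that `𝐓^{(j)}T` be INTEGRABLE along the
sections of the scale-`(j+1)` variables (the conditional positivity `integral_condLaw_section_pos_ae` reads an integrable section).  Integrability does not follow from positivity; it is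
propagated separately: a UNIFORM bound `∫⁻ T ∘ c ≤ M` over all sections `c` on `sV_j` gives `∫⁻ (𝐓^{(j)}T) ∘ c′ ≤ c₀ · M` over all sections `c′` on any `S′ ⊇ sV′_j`, because the marginal
density times the conditional law is dominated by the joint law, the graph image of `Π_{sV}Haar` (g10's `lintegral_margDensity_condLaw_le`, NO absolute continuity of the averaging
needed) — §1.  §2 supplies what both steps read off the Gaussian-bare weights of record at generation `j`: the empty-branch
A-weight `w_j` depends on the scale-`j` fluctuation variables only (blind to every other scale, measurable) and its fibre integral at zero scale-`j` fluctuation is O2's positive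
constant (`sV′_j ⊆ sV_{j+1}` is this seat's g11 `…N11TkIteratedFibreReading.sV'_subset_sV_succ`, cited by the sequel).  The induction at the record is the sequel
(`…N11K1SupportsOffTopAllSteps`).

WHAT THIS FILE PROVES (theorems only; 0 `def`, 0 `sorry`).
§1 (generic lattice `P`, gauge group `G` with Haar datum, standard Borel; fluctuation space `V`) ★★★ `genOp_section_lintegral_le` — THE L¹ STEP: `∫⁻ ofReal (genOp j ⟨sV, sV′,
   kernelRT avg, 1, sA, w⟩ T (c′ z)) dΠ_{S′} ≤ ofReal c₀ · M` for every measurable zero-fluctuation section `c′` on `S′ ⊇ sV′` reading `z` on `sV′`, from `∫⁻ ofReal (T (c y)) dΠ_{sV} ≤ M`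
   for all such sections `c` on `sV` (glue `z = (z₁,z₂)`; for fixed `z₂`: `∫⁻ margDensity · ∫⁻(…)dcondLaw dΠ_{sV′} ≤ ∫⁻ T ∘ (section through the averaging) dΠ_{sV} ≤ M` by g10's
   inequality; the complementary variables integrate over a probability measure).
§2 (at the weights of record, Gaussian-bare literal along `Ω`) `w_gaussBare_empty_update_of_ne` (blind off scale `j`) · `measurable_w_gaussBare_empty` · ★ `integral_w_gaussBare_empty_update_eq`
   (the fibre integral at ANY configuration with zero scale-`j` fluctuation is O2's constant `c₀(j) > 0`).

HONEST FRAMING.  [folklore] measure theory (product measures, Fubini, disintegration) about the published formulas (2.21) ∕ (3.16) ∕ (3.23) [III] over landed definitions; the cites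
are LOCATORS; nothing of Bałaban's estimates asserted or refuted; no K1⁹ witness; N11 NOT discharged; K1⁹ NOT closed; counts unmoved (typed 28∕28 · discharged 8∕27 = 8∕28 incl.
NODE O).  One finite four-torus programme at fixed `ε = L^{−K}`; NOT ℝ⁴, NOT OS, NOT a mass gap, NOT Clay.  No `sorry`, `axiom`, `def`, `instance`, `notation`.  Sources (locators):
[III] (2.18) p.257, (2.20)–(2.22) p.258, (3.16) p.268, (3.23)–(3.24) p.270; [Balaban1985Averaging] (10) p.19.
-/

noncomputable section

open MeasureTheory Function ProbabilityTheory
open scoped BigOperators ENNReal NNReal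

namespace Summit.QuantumFields.YangMills.Theorems.BalabanUVNodesN11OffTopSupportsL1Step

open Literature.MathematicalPhysics.QuantumFieldTheory.Balaban1983to89 T4Continuum T4AveragingDisintegration
open T4AdjointCovariance (insA JCfg)
open T4NestedCovariance (Op)
open Node00 Node00.Tk
open BalabanUVNodesN11OffTopSupportsGenerationStep
open BalabanUVNodesN11TkBranchMassBoundCore (ofReal_integral_le_lintegral_ofReal_of_nonneg lintegral_margDensity_condLaw_le)

universe u

/-! ## §1  THE GENERATION STEP FOR THE L¹ BOUND: `∫⁻ 𝐓^{(j)}T ∘ section ≤ c₀ · M` along sections of the coarse variables, from `∫⁻ T ∘ section ≤ M` along sections of the fine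
variables (the marginal density times the conditional law is dominated by the graph image of the fine product Haar — no absolute continuity needed) -/

section L1Step

variable {P : Params} {G : Type u} {V : Type u}
variable [GaugeGroup G] [MeasurableSpace G] [HaarData G] [StandardBorelSpace G]
variable [NormedAddCommGroup V] [InnerProductSpace ℝ V] [FiniteDimensional ℝ V] [MeasurableSpace V] [BorelSpace V]

/-- ★★★ **THE GENERATION STEP (L¹ BOUND).**  In the setting of `genOp_section_pos_ae` (no absolute continuity of the averaging needed here): if `∫⁻ T ∘ c ≤ M` along every
measurable zero-fluctuation section `c` of the scale-`j` variables on `sV`, then `∫⁻ (𝐓^{(j)}T) ∘ c′ ≤ c₀ · M` along every measurable zero-fluctuation section `c′` of the scale-`(j+1)`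
variables on any `S′ ⊇ sV′` reading the section parameter on `sV′`.  MECHANISM: `𝐓^{(j)}T(c′ z) = margDensity(π z)·c₀·∫ T dcondLaw(π z)`; glue `z = (z₁, z₂)`; for fixed `z₂`,
`∫⁻ margDensity·(∫⁻ … dcondLaw) dΠ_{sV′} ≤ ∫⁻ T(section through the averaging) dΠ_{sV} ≤ M` (g10's `lintegral_margDensity_condLaw_le`: `withDensity (rnDeriv) ≤` the joint law's
marginal, the conditional kernel disintegrates the joint law, the joint law is the graph image); the complementary variables integrate over a probability measure.
[cite: Balaban1988Convergent, (2.20)–(2.22) p.258; Balaban1985Averaging, (10) p.19 (bookkeeping)] -/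
theorem genOp_section_lintegral_le (j : ℕ) [DecidableEq (PBond P j)] [DecidableEq (PBond P (j + 1))] (sV : Finset (PBond P j)) (sV' : Finset (PBond P (j + 1)))
    {avg : (↥sV → G) → (↥sV' → G)} (havg : Measurable avg) (sA : Finset (PBond P j)) (w : MultiCfg P G V → ℝ) {c₀ : ℝ} (hc₀ : 0 ≤ c₀)
    (hwN : ∀ ω : MultiCfg P G V, (ω j).2 = 0 → ∫ a, w (Function.update ω j (insA sA a (ω j))) ∂(Measure.pi fun _ : ↥sA => (volume : Measure V)) = c₀)
    {T : MultiCfg P G V → ℝ} (hT0 : ∀ ω, 0 ≤ T ω) (hTm : Measurable T) (hTfl : ∀ ω (c : JCfg P j G V), c.1 = (ω j).1 → T (Function.update ω j c) = T ω)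
    {M : ℝ≥0∞} (hTI : ∀ c : (↥sV → G) → MultiCfg P G V, Measurable c → (∀ y (b : ↥sV), ((c y) j).1 b = y b) → (∀ y i, ((c y) i).2 = 0) →
      ∫⁻ y, ENNReal.ofReal (T (c y)) ∂(Measure.pi fun _ : ↥sV => (HaarData.haar : Measure G)) ≤ M)
    (S' : Finset (PBond P (j + 1))) (hS' : sV' ⊆ S') (c : (↥S' → G) → MultiCfg P G V) (hc : Measurable c)
    (hcr : ∀ z (b : PBond P (j + 1)) (hb : b ∈ sV'), ((c z) (j + 1)).1 b = z ⟨b, hS' hb⟩) (hcz : ∀ z i, ((c z) i).2 = 0) :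
    ∫⁻ z, ENNReal.ofReal (genOp j ⟨sV, sV', kernelRT avg, fun _ => 1, sA, w⟩ T (c z)) ∂(Measure.pi fun _ : ↥S' => (HaarData.haar : Measure G)) ≤ ENNReal.ofReal c₀ * M := by
  set ν : Measure (↥sV → G) := Measure.pi fun _ : ↥sV => (HaarData.haar : Measure G) with hν
  set μ : Measure (↥sV' → G) := Measure.pi fun _ : ↥sV' => (HaarData.haar : Measure G) with hμ
  set π : (↥S' → G) → (↥sV' → G) := fun z b => z ⟨b.1, hS' b.2⟩ with hπ
  have hπmeas : Measurable π := measurable_pi_lambda _ fun b => measurable_pi_apply _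
  have hread : ∀ z, (fun b : ↥sV' => ((c z) (j + 1)).1 b) = π z := fun z => funext fun b => hcr z b.1 b.2
  -- the joint integrand `(z, y) ↦ T((c z)[V_j|_{sV} := y])`
  set g : (↥S' → G) → (↥sV → G) → ℝ := fun z y => T (Function.update (c z) j (Function.updateFinset ((c z) j).1 sV y, ((c z) j).2)) with hg
  have hgm : Measurable (uncurry g) := hTm.comp ((measurable_vUpdate (G := G) (V := V) j sV).comp ((hc.comp measurable_fst).prodMk measurable_snd))
  have hgen : ∀ z, genOp j ⟨sV, sV', kernelRT avg, fun _ => 1, sA, w⟩ T (c z) = (margDensity ν μ avg (π z) : ℝ) * (c₀ * ∫ y, g z y ∂(condLaw ν avg (π z))) := by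
    intro z
    rw [genOp_apply, vOp_apply]
    show kernelRT avg _ _ = _
    rw [hread z, kernelRT_apply, ← integral_const_mul c₀]
    congr 1
    refine integral_congr_ae (Filter.Eventually.of_forall fun y => ?_)
    set ω := Function.update (c z) j (Function.updateFinset ((c z) j).1 sV y, ((c z) j).2) with hω
    have hω0 : (ω j).2 = 0 := by rw [hω, Function.update_self]; exact hcz z j
    show (1 : ℝ) * aOp j sA w T ω = c₀ * T ω
    rw [one_mul, aOp_of_indep j sA w T ω (fun a => hTfl ω _ rfl), hwN ω hω0]
  -- pointwise bound of the integrand by the `ℝ≥0∞`-shaped product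
  have hH : Measurable fun p : (↥sV' → G) × (↥S' → G) => ∫⁻ y, ENNReal.ofReal (g p.2 y) ∂(condLaw ν avg p.1) := by
    have h1 : Measurable fun q : ((↥sV' → G) × (↥S' → G)) × (↥sV → G) => ENNReal.ofReal (g q.1.2 q.2) :=
      ENNReal.measurable_ofReal.comp (hgm.comp ((measurable_snd.comp measurable_fst).prodMk measurable_snd))
    exact h1.lintegral_kernel_prod_right' (κ := (condLaw ν avg).comap Prod.fst measurable_fst)
  have hbound : ∀ z, ENNReal.ofReal (genOp j ⟨sV, sV', kernelRT avg, fun _ => 1, sA, w⟩ T (c z)) ≤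
      (margDensity ν μ avg (π z) : ℝ≥0∞) * (ENNReal.ofReal c₀ * ∫⁻ y, ENNReal.ofReal (g z y) ∂(condLaw ν avg (π z))) := fun z => by
    rw [hgen z, ENNReal.ofReal_mul (margDensity ν μ avg (π z)).coe_nonneg, ENNReal.ofReal_coe_nnreal, ENNReal.ofReal_mul hc₀]
    gcongr
    exact ofReal_integral_le_lintegral_ofReal_of_nonneg _ fun y => hT0 _
  refine (lintegral_mono hbound).trans ?_
  -- glue the coarse variables: `z = (z₁ on sV′, z₂ off sV′)`
  have hglue := measurePreserving_glue (G := G) hS'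
  have hF : Measurable fun z : ↥S' → G => (margDensity ν μ avg (π z) : ℝ≥0∞) * (ENNReal.ofReal c₀ * ∫⁻ y, ENNReal.ofReal (g z y) ∂(condLaw ν avg (π z))) :=
    (measurable_margDensity.comp hπmeas).coe_nnreal_ennreal.mul (measurable_const.mul (hH.comp (hπmeas.prodMk measurable_id)))
  rw [← hglue.lintegral_comp hF]
  have hFg : AEMeasurable (fun q : (↥sV' → G) × ({b : ↥S' // (b : PBond P (j + 1)) ∉ sV'} → G) =>
      (margDensity ν μ avg (π (fun b : ↥S' => if hb : (b : PBond P (j + 1)) ∈ sV' then q.1 ⟨b.1, hb⟩ else q.2 ⟨b, hb⟩)) : ℝ≥0∞) *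
        (ENNReal.ofReal c₀ * ∫⁻ y, ENNReal.ofReal (g (fun b : ↥S' => if hb : (b : PBond P (j + 1)) ∈ sV' then q.1 ⟨b.1, hb⟩ else q.2 ⟨b, hb⟩) y)
          ∂(condLaw ν avg (π (fun b : ↥S' => if hb : (b : PBond P (j + 1)) ∈ sV' then q.1 ⟨b.1, hb⟩ else q.2 ⟨b, hb⟩)))))
      (μ.prod (Measure.pi fun _ : {b : ↥S' // (b : PBond P (j + 1)) ∉ sV'} => (HaarData.haar : Measure G))) :=
    (hF.comp hglue.measurable).aemeasurable
  rw [lintegral_prod_symm _ hFg]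
  -- for every complementary configuration the inner integral is `≤ c₀·M`
  have hinner : ∀ z₂ : {b : ↥S' // (b : PBond P (j + 1)) ∉ sV'} → G,
      ∫⁻ z₁, (margDensity ν μ avg (π (fun b : ↥S' => if hb : (b : PBond P (j + 1)) ∈ sV' then z₁ ⟨b.1, hb⟩ else z₂ ⟨b, hb⟩)) : ℝ≥0∞) *
          (ENNReal.ofReal c₀ * ∫⁻ y, ENNReal.ofReal (g (fun b : ↥S' => if hb : (b : PBond P (j + 1)) ∈ sV' then z₁ ⟨b.1, hb⟩ else z₂ ⟨b, hb⟩) y)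
            ∂(condLaw ν avg (π (fun b : ↥S' => if hb : (b : PBond P (j + 1)) ∈ sV' then z₁ ⟨b.1, hb⟩ else z₂ ⟨b, hb⟩)))) ∂μ ≤ ENNReal.ofReal c₀ * M := by
    intro z₂
    set gl : (↥sV' → G) → (↥S' → G) := fun z₁ b => if hb : (b : PBond P (j + 1)) ∈ sV' then z₁ ⟨b.1, hb⟩ else z₂ ⟨b, hb⟩ with hgl
    have hglm : Measurable gl := by
      refine measurable_pi_lambda _ fun b => ?_
      by_cases hb : (b : PBond P (j + 1)) ∈ sV'
      · simp only [hgl, hb, dif_pos]; exact measurable_pi_apply _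
      · simp only [hgl, hb, dif_neg, not_false_eq_true]; exact measurable_const
    have hπgl : ∀ z₁, π (gl z₁) = z₁ := fun z₁ => by
      funext b; show (if hb : ((⟨b.1, hS' b.2⟩ : ↥S') : PBond P (j + 1)) ∈ sV' then z₁ ⟨b.1, hb⟩ else _) = z₁ b; rw [dif_pos b.2]
    show ∫⁻ z₁, (margDensity ν μ avg (π (gl z₁)) : ℝ≥0∞) * (ENNReal.ofReal c₀ * ∫⁻ y, ENNReal.ofReal (g (gl z₁) y) ∂(condLaw ν avg (π (gl z₁)))) ∂μ ≤ _
    simp_rw [hπgl]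
    -- the section through the averaging, on the fine variables
    have hsec : Measurable fun y : ↥sV → G => Function.update (c (gl (avg y))) j (Function.updateFinset ((c (gl (avg y))) j).1 sV y, ((c (gl (avg y))) j).2) :=
      (measurable_vUpdate (G := G) (V := V) j sV).comp (((hc.comp hglm).comp havg).prodMk measurable_id)
    have hsecr : ∀ (y : ↥sV → G) (b : ↥sV), ((Function.update (c (gl (avg y))) j (Function.updateFinset ((c (gl (avg y))) j).1 sV y, ((c (gl (avg y))) j).2)) j).1 b = y b :=
      fun y b => by rw [Function.update_self]; simp only [Function.updateFinset_def, dif_pos b.2]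
    have hsecz : ∀ (y : ↥sV → G) i, ((Function.update (c (gl (avg y))) j (Function.updateFinset ((c (gl (avg y))) j).1 sV y, ((c (gl (avg y))) j).2)) i).2 = 0 := fun y i => by
      by_cases hi : i = j
      · subst hi; rw [Function.update_self]; exact hcz _ _
      · rw [Function.update_of_ne hi]; exact hcz _ _
    have hM := hTI _ hsec hsecr hsecz
    -- the `z₁`-integrand is measurable
    have hG2 : Measurable fun q : (↥sV' → G) × (↥sV → G) => ENNReal.ofReal (g (gl q.1) q.2) :=
      ENNReal.measurable_ofReal.comp (hgm.comp ((hglm.comp measurable_fst).prodMk measurable_snd))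
    have hHz : Measurable fun z₁ : ↥sV' → G => ∫⁻ y, ENNReal.ofReal (g (gl z₁) y) ∂(condLaw ν avg z₁) := hG2.lintegral_kernel_prod_right'
    calc ∫⁻ z₁, (margDensity ν μ avg z₁ : ℝ≥0∞) * (ENNReal.ofReal c₀ * ∫⁻ y, ENNReal.ofReal (g (gl z₁) y) ∂(condLaw ν avg z₁)) ∂μ
        = ENNReal.ofReal c₀ * ∫⁻ z₁, (margDensity ν μ avg z₁ : ℝ≥0∞) * ∫⁻ y, ENNReal.ofReal (g (gl z₁) y) ∂(condLaw ν avg z₁) ∂μ := by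
          rw [← lintegral_const_mul (ENNReal.ofReal c₀)
            (f := fun z₁ => (margDensity ν μ avg z₁ : ℝ≥0∞) * ∫⁻ y, ENNReal.ofReal (g (gl z₁) y) ∂(condLaw ν avg z₁)) (measurable_margDensity.coe_nnreal_ennreal.mul hHz)]
          exact lintegral_congr fun z₁ => mul_left_comm _ _ _
      _ ≤ ENNReal.ofReal c₀ * ∫⁻ y, ENNReal.ofReal (g (gl (avg y)) y) ∂ν := by
          gcongr
          exact lintegral_margDensity_condLaw_le ν μ havg hG2
      _ ≤ ENNReal.ofReal c₀ * M := by gcongr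
  calc ∫⁻ z₂, ∫⁻ z₁, (margDensity ν μ avg (π (fun b : ↥S' => if hb : (b : PBond P (j + 1)) ∈ sV' then z₁ ⟨b.1, hb⟩ else z₂ ⟨b, hb⟩)) : ℝ≥0∞) *
          (ENNReal.ofReal c₀ * ∫⁻ y, ENNReal.ofReal (g (fun b : ↥S' => if hb : (b : PBond P (j + 1)) ∈ sV' then z₁ ⟨b.1, hb⟩ else z₂ ⟨b, hb⟩) y)
            ∂(condLaw ν avg (π (fun b : ↥S' => if hb : (b : PBond P (j + 1)) ∈ sV' then z₁ ⟨b.1, hb⟩ else z₂ ⟨b, hb⟩)))) ∂μ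
        ∂(Measure.pi fun _ : {b : ↥S' // (b : PBond P (j + 1)) ∉ sV'} => (HaarData.haar : Measure G))
      ≤ ∫⁻ _z₂, ENNReal.ofReal c₀ * M ∂(Measure.pi fun _ : {b : ↥S' // (b : PBond P (j + 1)) ∉ sV'} => (HaarData.haar : Measure G)) := lintegral_mono fun z₂ => hinner z₂
    _ = ENNReal.ofReal c₀ * M := by rw [lintegral_const, measure_univ, mul_one]

end L1Step

/-! ## §2  OF RECORD: the Gaussian-bare weights along a history — blindness off the working scale, measurability, the constant positive A-normaliser; the inclusion
`sV′_i ⊆ sV_{i+1}` of 11a's bond sets along the window -/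

section OfRecord

open B10Eq42TorusConstraint (bondsIn)
open B14.Eq218Concrete B14.Sect3Decomp
open BalabanUVNodesN11TkOpMeasurable (measurable_chiAW)
open BalabanUVNodesN11K1SupportsOmegaTopGaussianDial (chiAW_empty_eq_chiSmallAW')
open BalabanUVNodesN11K1SupportsOffTopFirstStep (w_gaussBare_empty_update_eq integral_afibre_gaussBare_empty_pos)

variable {F : T4Family} {N : ℕ} [NeZero N]
variable (ν : Stage7Numerics) (A₁ : ℝ) (M : ℕ) (p : B12.RunParams) (g : ℕ → ℝ) (Ω : ℕ → Set (Site (F.P p.K) 0))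

/-- **THE EMPTY-BRANCH GAUSSIAN-BARE A-WEIGHT OF GENERATION `j` READS SCALE `j` ONLY**: it is blind to every update at a scale `m ≠ j`. [cite: Balaban1988Convergent, (2.21) p.258, (3.16) p.268 (bookkeeping)] -/
theorem w_gaussBare_empty_update_of_ne (j : ℕ) (Λ' Y : Set (Site (F.P p.K) 0)) {m : ℕ} (hm : m ≠ j) (ω : MultiCfg (F.P p.K) (Node00.SU N) (FluctV N))
    (c : JCfg (F.P p.K) m (Node00.SU N) (FluctV N)) :
    (⟨fun _ _ _ => 1, fun j Λ' ω => ∑ b ∈ (Set.toFinite (bondsIn j (Λ'ᶜ ∩ Ω (j + 1)))).toFinset, ‖(ω j).2 b‖ ^ 2,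
        chiAW F N (FluctV N) ν A₁ p g⟩ : TkWeights F N (FluctV N) p.K).w j Λ' Y ∅ (Function.update ω m c) =
      (⟨fun _ _ _ => 1, fun j Λ' ω => ∑ b ∈ (Set.toFinite (bondsIn j (Λ'ᶜ ∩ Ω (j + 1)))).toFinset, ‖(ω j).2 b‖ ^ 2,
        chiAW F N (FluctV N) ν A₁ p g⟩ : TkWeights F N (FluctV N) p.K).w j Λ' Y ∅ ω := by
  have hj : (Function.update ω m c) j = ω j := Function.update_of_ne (Ne.symm hm) _ _
  show chiAW F N (FluctV N) ν A₁ p g j Y ∅ (Function.update ω m c) * Real.exp (-(1 / 2 : ℝ) * ∑ b ∈ _, ‖((Function.update ω m c) j).2 b‖ ^ 2) =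
    chiAW F N (FluctV N) ν A₁ p g j Y ∅ ω * Real.exp (-(1 / 2 : ℝ) * ∑ b ∈ _, ‖(ω j).2 b‖ ^ 2)
  rw [chiAW_empty_eq_chiSmallAW', chiAW_empty_eq_chiSmallAW', hj]
  show B14.Eq316.chiK (bondsStarW F ν p g j) ((Function.update ω m c) j).2 _ _ * _ = _
  rw [hj]
  rfl

/-- **MEASURABILITY OF THE EMPTY-BRANCH GAUSSIAN-BARE A-WEIGHT** on the all-scales configuration. [cite: Balaban1988Convergent, (2.21) p.258 (bookkeeping)] -/
theorem measurable_w_gaussBare_empty (j : ℕ) (Λ' Y : Set (Site (F.P p.K) 0)) :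
    Measurable ((⟨fun _ _ _ => 1, fun j Λ' ω => ∑ b ∈ (Set.toFinite (bondsIn j (Λ'ᶜ ∩ Ω (j + 1)))).toFinset, ‖(ω j).2 b‖ ^ 2,
        chiAW F N (FluctV N) ν A₁ p g⟩ : TkWeights F N (FluctV N) p.K).w j Λ' Y ∅) := by
  have hq : Measurable fun ω : MultiCfg (F.P p.K) (Node00.SU N) (FluctV N) => ∑ b ∈ (Set.toFinite (bondsIn j (Λ'ᶜ ∩ Ω (j + 1)))).toFinset, ‖(ω j).2 b‖ ^ 2 := by
    refine Finset.measurable_sum _ fun b _ => ?_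
    exact (((measurable_pi_apply b).comp (measurable_snd.comp (measurable_pi_apply j))).norm).pow_const 2
  exact (measurable_chiAW F N (FluctV N) ν A₁ p g j Y ∅).mul (Real.measurable_exp.comp (measurable_const.mul hq))

/-- **THE A-NORMALISER OF GENERATION `j` IS THE POSITIVE CONSTANT `c₀(j)` AT EVERY CONFIGURATION WITH VANISHING SCALE-`j` FLUCTUATION VARIABLES** (O2 §1).
[cite: Balaban1988Convergent, (2.21) p.258, (3.16) p.268, (3.21) p.269 (bookkeeping)] -/
theorem integral_w_gaussBare_empty_update_eq (j : ℕ) (Λ' : Set (Site (F.P p.K) 0)) {hdec : DecidableEq (PBond (F.P p.K) j)}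
    (ω : MultiCfg (F.P p.K) (Node00.SU N) (FluctV N)) (hω : (ω j).2 = 0) :
    ∫ a : ↥(Set.toFinite (bondsIn j (Λ'ᶜ ∩ Ω (j + 1)))).toFinset → FluctV N,
        (⟨fun _ _ _ => 1, fun j Λ' ω => ∑ b ∈ (Set.toFinite (bondsIn j (Λ'ᶜ ∩ Ω (j + 1)))).toFinset, ‖(ω j).2 b‖ ^ 2,
          chiAW F N (FluctV N) ν A₁ p g⟩ : TkWeights F N (FluctV N) p.K).w j Λ' (Λ'ᶜ ∩ Ω (j + 1)) ∅
          (Function.update ω j (insA (Set.toFinite (bondsIn j (Λ'ᶜ ∩ Ω (j + 1)))).toFinset a (ω j))) ∂(Measure.pi fun _ => (volume : Measure (FluctV N))) =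
      ∫ a : ↥(Set.toFinite (bondsIn j (Λ'ᶜ ∩ Ω (j + 1)))).toFinset → FluctV N,
        B14.Eq316.chiK (bondsStarW F ν p g j) (Function.updateFinset (0 : VecField (F.P p.K) j (FluctV N)) (Set.toFinite (bondsIn j (Λ'ᶜ ∩ Ω (j + 1)))).toFinset a)
            (deltaOfRecord ν g j A₁) (cubesIn (cubeχ F ν p g j) (Λ'ᶜ ∩ Ω (j + 1))) *
          Real.exp (-(1 / 2 : ℝ) * ∑ b ∈ (Set.toFinite (bondsIn j (Λ'ᶜ ∩ Ω (j + 1)))).toFinset,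
            ‖(Function.updateFinset (0 : VecField (F.P p.K) j (FluctV N)) (Set.toFinite (bondsIn j (Λ'ᶜ ∩ Ω (j + 1)))).toFinset a) b‖ ^ 2)
        ∂(Measure.pi fun _ => (volume : Measure (FluctV N))) :=
  integral_congr_ae (Filter.Eventually.of_forall fun a => w_gaussBare_empty_update_eq ν A₁ p g Ω j Λ' (Λ'ᶜ ∩ Ω (j + 1)) _ ω hω a)

end OfRecord

end Summit.QuantumFields.YangMills.Theorems.BalabanUVNodesN11OffTopSupportsL1Step

end
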